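/-
Copyright (c) 2026 the pub-hodgecm-mathlib formalisation cell (harness21).  Prover seat hodgecm-mathlib-F0P2-p11 (g4), routed by chair K2-lead (g2) VALVE 22 (z) to R90-TF section S8
«ContSpec-n½» (dealer R90-CS-plan (g3), S8-R247 (2) 2026-09-05T03:13Z): `K2E1ChiUnfoldingBoundedAmplitudeU3` — FILE 1∕2 of the «`hunfK` for an arbitrary pure-tensor K-finite
generator» deal: ★ (a-3) `differentiableOn_chiAmplitude_three` and ★ p864845 FILE A's `∃ A` engine with BOUNDED (not unit-ball) weights.  FILE 2∕2 = `K2E1ChiUnfoldingAtKmaxPureTensorU3`.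
-/
import Summits.HodgeConjecture.HodgeConjecture.Theorems.K2E1ChiUnfoldingHolomorphicAmplitudeU3   -- ★ p864845 FILE A (K2E1-p14): `unfolding_eq_ratio_mul_amplitude_of_letters`; brings ★ (a-3), ★ p864662 constants
import Summits.HodgeConjecture.HodgeConjecture.Theorems.K2E1ChiArchAmplitudeOfKTypeVectorU3        -- ★ p864935 (K2E2-p12): `differentiableOn_integral_integral_archAmplitude_of_norm_le` (arch weight of ANY bound)
import HarnessLib

/-!
# K2·E1 ∕ R90·S8 — `K2E1ChiUnfoldingBoundedAmplitudeU3` (FILE 1∕2): THE (a-2b) AMPLITUDE IS HOLOMORPHIC, AND FILE A's UNFOLDING ROW HOLDS, FOR BOUNDED WEIGHTS `‖ω_v‖ ≤ M_v`, `‖ω_∞‖ ≤ M_∞`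

Cell `pub/hodgecm-mathlib`, crux h413 = `stmt-HodgeConjecture-24833`, route of record `HCCMUnconditional`; R90-TF section S8 «ContSpec-n½», road R2-χ₃ (the per-generator unfolding core
`hunfK^φ` for EVERY `K`-finite generator; dealer R90-CS-plan (g3) S8-R247 (2); consumers K2E2-p12 (g10)'s KFinite Euler heads ★ p864880, K2E1-p13 (g6)'s assembly).  THEOREMS ONLY (no
`def`, no `instance`, no notation, no named-fact hypothesis, no `sorry`; default heartbeats); lane `--supports stmt-HodgeConjecture-24833 --as helper` (count-neutral).  Closes no socket.

THE MATHEMATICS ([MoeglinWaldspurger1995] II.1.7, IV.1.11; [Titchmarsh1939] §2.8).  ★ (a-3) `differentiableOn_chiAmplitude_three` and ★ p864845 `exists_differentiableOn_unfolding_eq_ratio_mul_of_letters`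
hard-wire the witness's normalisation `‖ω_v‖ ≤ 1` (`v ∈ S₀`), `‖ω_∞‖ ≤ 1`; a general `K`-finite generator has BOUNDED measurable readings.  Rescaling PER FACTOR —
`∫ ω·Q^{−z} = M̃·∫ (M̃⁻¹ω)·Q^{−z}` with `M̃ := max M 1 > 0` (`integral_const_mul`, unconditional) — puts each weighted local ∕ archimedean factor back into ★ (a-3)'s unit ball, so the
amplitude `A(z) = C·(∫∫ ω_∞·ARCH₃^{−z})·∏_{v∈S₀} m_v(z)` is holomorphic on `{1 < Re z}` for bounded weights (§1; the archimedean factor is ★ p864935, K2E2-p12); ★ (a-2b)'s identity ★ `unfolding_eq_ratio_mul_amplitude_of_letters` is bound-free,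
so FILE A's `∃ A` head holds verbatim with `≤ Mv v`∕`≤ Minf` in place of `≤ 1` (§2).
* §1 `norm_inv_max_mul_le_one`, `mul_eq_mul_inv_mul_mul`, `integral_weight_mul_eq_const_mul` (rescaling); `differentiableOn_integral_chiWeight_mul_localHeight_cpow_neg_of_bound`,
  `differentiableOn_chiLocalMean_three_of_bound`, `differentiableOn_finsetProd_chiLocalMean_three_of_bounds` (FINITE weights of any bound — the archimedean twin is ★ p864935
  `K2E1ChiArchAmplitudeOfKTypeVectorU3.differentiableOn_integral_integral_archAmplitude_of_norm_le`, K2E2-p12), **`differentiableOn_chiAmplitude_three_of_bounds`** (★ (a-3)'s conclusion bytes,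
  both bounds free; ★ p864935's `…_of_norm_le` frees only the archimedean one).
* §2 **`exists_differentiableOn_unfolding_eq_ratio_mul_of_bounded_letters`** — ★ p864845's head, `hωb`∕`hωinfb` relaxed to bounds, every other binder VERBATIM.
HONEST LABEL: HC_CM is proved only modulo the 7 printed citations (2 remaining named inputs: hLiu418 = `stmt-HodgeConjecture-24832`, h413 = `stmt-HodgeConjecture-24833`) until rung 0
closes; REL ≠ ★ ≠ BUILT; this file asserts no named fact and closes no socket; count-neutral.

## References
* [MoeglinWaldspurger1995] C. Mœglin, J.-L. Waldspurger, *Spectral Decomposition and Eisenstein Series* (1995): II.1.6–II.1.7, IV.1.11.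
* [Langlands1976] R. P. Langlands, *On the Functional Equations Satisfied by Eisenstein Series*, LNM 544 (1976): Appendix (rank one).
* [Titchmarsh1939] E. C. Titchmarsh, *The Theory of Functions*, 2nd ed. (1939): §2.8 (holomorphy of parametric integrals).
* [Rogawski1990] J. D. Rogawski, *Automorphic Representations of Unitary Groups in Three Variables*, Ann. of Math. Stud. 123 (1990): §13.9 p. 229.
-/

set_option autoImplicit false
set_option linter.dupNamespace false -- the mandated namespace repeats `HodgeConjecture.HodgeConjecture`

noncomputable section

open MeasureTheory MeasureTheory.Measure NumberField NumberField.InfinitePlace IsDedekindDomain Filter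
open scoped NNReal ENNReal
open Literature.NumberTheory.Automorphic Literature.NumberTheory.Automorphic.UnitaryGroup Literature.NumberTheory.GaloisRepresentations AdelicGroupData
open Literature.NumberTheory.GaloisRepresentations.IsNonarchimedeanLocalField Literature.NumberTheory.LFunctions
open Literature.NumberTheory.Automorphic.Arthur2013.Leaves.TECR
open Summit.HodgeConjecture.HodgeConjecture.Cruxes.H413
open Summit.HodgeConjecture.HodgeConjecture.Cruxes.H413.K2E1BorelEisensteinU
open Summit.HodgeConjecture.HodgeConjecture.Cruxes.H413.K2E1CharacterEisensteinU3PairDefs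
open Summit.HodgeConjecture.HodgeConjecture.Cruxes.H413.K2E1ChiUnfoldingConstantsOfRecordU3 (unfoldingHaarConst)
open Summit.HodgeConjecture.HodgeConjecture.Cruxes.H413.K2E1ChiIntertwiningLocalFactorHolomorphicU3 (differentiableOn_integral_chiWeight_mul_localHeight_cpow_neg)
open Summit.HodgeConjecture.HodgeConjecture.Cruxes.H413.K2E1ChiArchAmplitudeOfKTypeVectorU3 (differentiableOn_integral_integral_archAmplitude_of_norm_le)
open Summit.HodgeConjecture.HodgeConjecture.Cruxes.H413.K2E1ChiUnfoldingHolomorphicAmplitudeU3 (unfolding_eq_ratio_mul_amplitude_of_letters)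

namespace Summit.HodgeConjecture.HodgeConjecture.Cruxes.H413.K2E1ChiUnfoldingBoundedAmplitudeU3

/-! ## §1 Rescaling a bounded weight into the unit ball; the (a-2b) amplitude is holomorphic for bounded weights -/

section Rescale

/-- **`‖(max M 1)⁻¹·ω‖ ≤ 1`** for any weight with `‖ω‖ ≤ M`. [folklore] -/
theorem norm_inv_max_mul_le_one {α : Type*} {ω : α → ℂ} {M : ℝ} (hωb : ∀ p, ‖ω p‖ ≤ M) (p : α) : ‖(((max M 1 : ℝ)) : ℂ)⁻¹ * ω p‖ ≤ 1 := by
  have hc : 0 < max M 1 := lt_of_lt_of_le one_pos (le_max_right M 1)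
  rw [norm_mul, norm_inv, Complex.norm_of_nonneg hc.le]
  calc (max M 1)⁻¹ * ‖ω p‖ ≤ (max M 1)⁻¹ * max M 1 := mul_le_mul_of_nonneg_left ((hωb p).trans (le_max_left M 1)) (inv_nonneg.2 hc.le)
    _ = 1 := inv_mul_cancel₀ hc.ne'

/-- `x·y = c·((c⁻¹·x)·y)` for `c ≠ 0` (the pointwise rescaling under the integral sign). [folklore] -/
theorem mul_eq_mul_inv_mul_mul {c x y : ℂ} (hc : c ≠ 0) : x * y = c * (c⁻¹ * x * y) := by
  rw [← mul_assoc, ← mul_assoc, mul_inv_cancel₀ hc, one_mul]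

/-- `∫ ω·F = c·∫ (c⁻¹ω)·F` (`c ≠ 0`; `integral_const_mul`, no integrability needed). [folklore] -/
theorem integral_weight_mul_eq_const_mul {X : Type*} [MeasurableSpace X] (μ : Measure X) (ω F : X → ℂ) {c : ℂ} (hc : c ≠ 0) :
    ∫ x, ω x * F x ∂μ = c * ∫ x, c⁻¹ * ω x * F x ∂μ := by
  rw [← integral_const_mul]
  exact integral_congr_ae (Eventually.of_forall fun x => mul_eq_mul_inv_mul_mul hc)

end Rescale

variable (L : Type) [Field L] [NumberField L] [IsCMField L] (hc : IsCMField.complexConj L * IsCMField.complexConj L = 1)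
  {δ : L} (hcδ : IsCMField.complexConj L δ = -δ) (hδ : δ ≠ 0) {d : ↥(maximalRealSubfield L)} (hd : δ * δ = algebraMap ↥(maximalRealSubfield L) L d)

section Finite

variable (v : HeightOneSpectrum (𝓞 ↥(maximalRealSubfield L)))
  [MeasurableSpace (v.adicCompletion ↥(maximalRealSubfield L))] [BorelSpace (v.adicCompletion ↥(maximalRealSubfield L))] (νv : Measure (v.adicCompletion ↥(maximalRealSubfield L))) [νv.IsAddHaarMeasure]

include hd in
/-- **`z ↦ ∫ ω_v·Q_v^{−z}` IS HOLOMORPHIC ON `{1 < Re z}` FOR EVERY a.e.-measurable weight with `‖ω_v‖ ≤ M`** — ★ (a-3) `differentiableOn_integral_chiWeight_mul_localHeight_cpow_neg` at the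
rescaled weight `(max M 1)⁻¹·ω_v` (unit ball) and `∫ ω·Q^{−z} = (max M 1)·∫ ((max M 1)⁻¹ω)·Q^{−z}`. [cite: Titchmarsh1939, §2.8] [cite: MoeglinWaldspurger1995, IV.1.11] -/
theorem differentiableOn_integral_chiWeight_mul_localHeight_cpow_neg_of_bound (ω : (Fin 3 → v.adicCompletion ↥(maximalRealSubfield L)) → ℂ)
    (hω : AEStronglyMeasurable ω (Measure.pi fun _ : Fin 3 => νv)) {M : ℝ} (hωb : ∀ p, ‖ω p‖ ≤ M) :
    DifferentiableOn ℂ (fun z : ℂ => ∫ p : Fin 3 → v.adicCompletion ↥(maximalRealSubfield L),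
      ω p * (((∏ w' : PlacesOver L v, max 1 (max ((normAbs (w'.1.adicCompletion L) (quadraticLocalEquiv L v (IsCMField.complexConj L) hcδ hδ (p 0, p 1) w') : ℝ≥0) : ℝ)
            ((normAbs (w'.1.adicCompletion L) ((toLocalRing L v (p 2) * algebraMap L (LocalRing L v) δ -
              toLocalRing L v 2⁻¹ * (quadraticLocalEquiv L v (IsCMField.complexConj L) hcδ hδ (p 0, p 1) *
                conjLocal L (IsCMField.complexConj L) v (quadraticLocalEquiv L v (IsCMField.complexConj L) hcδ hδ (p 0, p 1)))) w') : ℝ≥0) : ℝ))) : ℝ) : ℂ) ^ (-z) ∂(Measure.pi fun _ : Fin 3 => νv)) {z : ℂ | 1 < z.re} := by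
  have hc0 : (((max M 1 : ℝ)) : ℂ) ≠ 0 := Complex.ofReal_ne_zero.2 (lt_of_lt_of_le one_pos (le_max_right M 1)).ne'
  have h := differentiableOn_integral_chiWeight_mul_localHeight_cpow_neg L hcδ hδ hd v νv (fun p => (((max M 1 : ℝ)) : ℂ)⁻¹ * ω p)
    (hω.const_mul _) (norm_inv_max_mul_le_one hωb)
  refine (h.const_mul (((max M 1 : ℝ)) : ℂ)).congr fun z _ => ?_
  exact integral_weight_mul_eq_const_mul _ ω _ hc0
include hd in
/-- **THE NORMALISED χ-LOCAL MEAN `m_v(z)` IS HOLOMORPHIC ON `{1 < Re z}` FOR A BOUNDED WEIGHT** (`‖ω_v‖ ≤ M`). [cite: Titchmarsh1939, §2.8] [cite: Langlands1976, Appendix] -/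
theorem differentiableOn_chiLocalMean_three_of_bound (ω : (Fin 3 → v.adicCompletion ↥(maximalRealSubfield L)) → ℂ)
    (hω : AEStronglyMeasurable ω (Measure.pi fun _ : Fin 3 => νv)) {M : ℝ} (hωb : ∀ p, ‖ω p‖ ≤ M) :
    DifferentiableOn ℂ (fun z : ℂ => ((Measure.pi fun _ : Fin 3 => νv) (integralBox ↥(maximalRealSubfield L) (Fin 3) v)).toReal⁻¹ •
      ∫ p : Fin 3 → v.adicCompletion ↥(maximalRealSubfield L),
        ω p * (((∏ w' : PlacesOver L v, max 1 (max ((normAbs (w'.1.adicCompletion L) (quadraticLocalEquiv L v (IsCMField.complexConj L) hcδ hδ (p 0, p 1) w') : ℝ≥0) : ℝ)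
            ((normAbs (w'.1.adicCompletion L) ((toLocalRing L v (p 2) * algebraMap L (LocalRing L v) δ -
              toLocalRing L v 2⁻¹ * (quadraticLocalEquiv L v (IsCMField.complexConj L) hcδ hδ (p 0, p 1) *
                conjLocal L (IsCMField.complexConj L) v (quadraticLocalEquiv L v (IsCMField.complexConj L) hcδ hδ (p 0, p 1)))) w') : ℝ≥0) : ℝ))) : ℝ) : ℂ) ^ (-z) ∂(Measure.pi fun _ : Fin 3 => νv)) {z : ℂ | 1 < z.re} :=
  (differentiableOn_integral_chiWeight_mul_localHeight_cpow_neg_of_bound L hcδ hδ hd v νv ω hω hωb).const_smul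
    (((Measure.pi fun _ : Fin 3 => νv) (integralBox ↥(maximalRealSubfield L) (Fin 3) v)).toReal⁻¹ : ℝ)
end Finite

section FiniteProduct

variable [∀ v : HeightOneSpectrum (𝓞 ↥(maximalRealSubfield L)), MeasurableSpace (v.adicCompletion ↥(maximalRealSubfield L))] [∀ v : HeightOneSpectrum (𝓞 ↥(maximalRealSubfield L)), BorelSpace (v.adicCompletion ↥(maximalRealSubfield L))]
  (νv : ∀ v : HeightOneSpectrum (𝓞 ↥(maximalRealSubfield L)), Measure (v.adicCompletion ↥(maximalRealSubfield L))) [∀ v, (νv v).IsAddHaarMeasure]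
  (S₀ : Finset (HeightOneSpectrum (𝓞 ↥(maximalRealSubfield L))))
  (ω : ∀ v : HeightOneSpectrum (𝓞 ↥(maximalRealSubfield L)), (Fin 3 → v.adicCompletion ↥(maximalRealSubfield L)) → ℂ)

include hd in
/-- **`z ↦ ∏_{v ∈ S₀} m_v(z)` IS HOLOMORPHIC ON `{1 < Re z}` FOR BOUNDED WEIGHTS** (`‖ω_v‖ ≤ M_v`, `v ∈ S₀`). [cite: Titchmarsh1939, §2.8] [cite: MoeglinWaldspurger1995, IV.1.11] -/
theorem differentiableOn_finsetProd_chiLocalMean_three_of_bounds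
    (hω : ∀ v ∈ S₀, AEStronglyMeasurable (ω v) (Measure.pi fun _ : Fin 3 => νv v)) {Mv : HeightOneSpectrum (𝓞 ↥(maximalRealSubfield L)) → ℝ} (hωb : ∀ v ∈ S₀, ∀ p, ‖ω v p‖ ≤ Mv v) :
    DifferentiableOn ℂ (fun z : ℂ => ∏ v ∈ S₀, ((Measure.pi fun _ : Fin 3 => νv v) (integralBox ↥(maximalRealSubfield L) (Fin 3) v)).toReal⁻¹ •
      ∫ p : Fin 3 → v.adicCompletion ↥(maximalRealSubfield L),
        ω v p * (((∏ w' : PlacesOver L v, max 1 (max ((normAbs (w'.1.adicCompletion L) (quadraticLocalEquiv L v (IsCMField.complexConj L) hcδ hδ (p 0, p 1) w') : ℝ≥0) : ℝ)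
            ((normAbs (w'.1.adicCompletion L) ((toLocalRing L v (p 2) * algebraMap L (LocalRing L v) δ -
              toLocalRing L v 2⁻¹ * (quadraticLocalEquiv L v (IsCMField.complexConj L) hcδ hδ (p 0, p 1) *
                conjLocal L (IsCMField.complexConj L) v (quadraticLocalEquiv L v (IsCMField.complexConj L) hcδ hδ (p 0, p 1)))) w') : ℝ≥0) : ℝ))) : ℝ) : ℂ) ^ (-z) ∂(Measure.pi fun _ : Fin 3 => νv v)) {z : ℂ | 1 < z.re} :=
  DifferentiableOn.fun_finsetProd fun v hv => differentiableOn_chiLocalMean_three_of_bound L hcδ hδ hd v (νv v) (ω v) (hω v hv) (hωb v hv)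
end FiniteProduct


section Amplitude

variable [MeasurableSpace (InfiniteAdeleRing L)] [BorelSpace (InfiniteAdeleRing L)]
  [MeasurableSpace (InfiniteAdeleRing ↥(maximalRealSubfield L))] [BorelSpace (InfiniteAdeleRing ↥(maximalRealSubfield L))]
  (μE₁ : Measure (InfiniteAdeleRing L)) [μE₁.IsAddHaarMeasure] (μF₁ : Measure (InfiniteAdeleRing ↥(maximalRealSubfield L))) [μF₁.IsAddHaarMeasure]
  [∀ v : HeightOneSpectrum (𝓞 ↥(maximalRealSubfield L)), MeasurableSpace (v.adicCompletion ↥(maximalRealSubfield L))] [∀ v : HeightOneSpectrum (𝓞 ↥(maximalRealSubfield L)), BorelSpace (v.adicCompletion ↥(maximalRealSubfield L))]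
  (νv : ∀ v : HeightOneSpectrum (𝓞 ↥(maximalRealSubfield L)), Measure (v.adicCompletion ↥(maximalRealSubfield L))) [∀ v, (νv v).IsAddHaarMeasure]

include hd in
/-- **THE χ-INTERTWINING AMPLITUDE `A(z) = C·(∫∫ ω_∞·ARCH₃^{−z})·∏_{v∈S₀} m_v(z)` IS HOLOMORPHIC ON `{1 < Re z}` FOR BOUNDED WEIGHTS** — ★ (a-3) `differentiableOn_chiAmplitude_three` with
`‖ω_v‖ ≤ M_v`, `‖ω_∞‖ ≤ M_∞` in place of `≤ 1` (same conclusion bytes; archimedean factor ★ p864935 `…archAmplitude_of_norm_le`, finite factors §1). [cite: MoeglinWaldspurger1995, IV.1.11] [cite: Langlands1976, Appendix] [cite: Titchmarsh1939, §2.8] -/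
theorem differentiableOn_chiAmplitude_three_of_bounds (C : ℂ) (S₀ : Finset (HeightOneSpectrum (𝓞 ↥(maximalRealSubfield L))))
    (ω : ∀ v : HeightOneSpectrum (𝓞 ↥(maximalRealSubfield L)), (Fin 3 → v.adicCompletion ↥(maximalRealSubfield L)) → ℂ)
    (hω : ∀ v ∈ S₀, AEStronglyMeasurable (ω v) (Measure.pi fun _ : Fin 3 => νv v)) {Mv : HeightOneSpectrum (𝓞 ↥(maximalRealSubfield L)) → ℝ} (hωb : ∀ v ∈ S₀, ∀ p, ‖ω v p‖ ≤ Mv v)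
    (ωinf : InfiniteAdeleRing L → InfiniteAdeleRing ↥(maximalRealSubfield L) → ℂ)
    (hωinf : AEStronglyMeasurable (fun p : InfiniteAdeleRing L × InfiniteAdeleRing ↥(maximalRealSubfield L) => ωinf p.1 p.2) (μE₁.prod μF₁)) {Minf : ℝ} (hωinfb : ∀ Xi a, ‖ωinf Xi a‖ ≤ Minf) :
    DifferentiableOn ℂ (fun z : ℂ => C * (∫ Xi : InfiniteAdeleRing L, ∫ a : InfiniteAdeleRing ↥(maximalRealSubfield L),
        ωinf Xi a * ((((∏ w : InfinitePlace L, ((1 + ‖(Xi) w‖ ^ 2 / 2) ^ 2 + (w δ) ^ 2 * (((InfiniteAdeleRing.ringEquiv_mixedSpace ↥(maximalRealSubfield L)) a).1 ⟨w.comap (algebraMap ↥(maximalRealSubfield L) L), K2E1HeightBigCellLineFormulaU2.isReal_comap_maximalRealSubfield L w⟩) ^ 2))) : ℝ) : ℂ) ^ (-z) ∂μF₁ ∂μE₁) *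
      ∏ v ∈ S₀, ((Measure.pi fun _ : Fin 3 => νv v) (integralBox ↥(maximalRealSubfield L) (Fin 3) v)).toReal⁻¹ •
        ∫ p : Fin 3 → v.adicCompletion ↥(maximalRealSubfield L),
          ω v p * (((∏ w' : PlacesOver L v, max 1 (max ((normAbs (w'.1.adicCompletion L) (quadraticLocalEquiv L v (IsCMField.complexConj L) hcδ hδ (p 0, p 1) w') : ℝ≥0) : ℝ)
            ((normAbs (w'.1.adicCompletion L) ((toLocalRing L v (p 2) * algebraMap L (LocalRing L v) δ -
              toLocalRing L v 2⁻¹ * (quadraticLocalEquiv L v (IsCMField.complexConj L) hcδ hδ (p 0, p 1) *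
                conjLocal L (IsCMField.complexConj L) v (quadraticLocalEquiv L v (IsCMField.complexConj L) hcδ hδ (p 0, p 1)))) w') : ℝ≥0) : ℝ))) : ℝ) : ℂ) ^ (-z) ∂(Measure.pi fun _ : Fin 3 => νv v)) {z : ℂ | 1 < z.re} :=
  (((differentiableOn_integral_integral_archAmplitude_of_norm_le L hδ μE₁ μF₁ ωinf hωinf hωinfb).const_mul C).mul
    (differentiableOn_finsetProd_chiLocalMean_three_of_bounds L hcδ hδ hd νv S₀ ω hω hωb))
end Amplitude

/-! ## §2 FILE A at bounded weights: the unfolding row with a holomorphic amplitude -/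

section Engine

variable [MeasurableSpace ↥(adelicUnipotent ↥(maximalRealSubfield L) L (IsCMField.complexConj L) 3)] [BorelSpace ↥(adelicUnipotent ↥(maximalRealSubfield L) L (IsCMField.complexConj L) 3)]
  [MeasurableSpace (AdeleRing (𝓞 L) L)] [BorelSpace (AdeleRing (𝓞 L) L)]
  [MeasurableSpace (AdeleRing (𝓞 ↥(maximalRealSubfield L)) ↥(maximalRealSubfield L))] [BorelSpace (AdeleRing (𝓞 ↥(maximalRealSubfield L)) ↥(maximalRealSubfield L))]
  [MeasurableSpace (InfiniteAdeleRing L)] [BorelSpace (InfiniteAdeleRing L)]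
  [MeasurableSpace (InfiniteAdeleRing ↥(maximalRealSubfield L))] [BorelSpace (InfiniteAdeleRing ↥(maximalRealSubfield L))]
  [MeasurableSpace (FiniteAdeleRing (𝓞 L) L)] [BorelSpace (FiniteAdeleRing (𝓞 L) L)]
  [MeasurableSpace (FiniteAdeleRing (𝓞 ↥(maximalRealSubfield L)) ↥(maximalRealSubfield L))] [BorelSpace (FiniteAdeleRing (𝓞 ↥(maximalRealSubfield L)) ↥(maximalRealSubfield L))]
  [∀ v : HeightOneSpectrum (𝓞 ↥(maximalRealSubfield L)), MeasurableSpace (v.adicCompletion ↥(maximalRealSubfield L))] [∀ v : HeightOneSpectrum (𝓞 ↥(maximalRealSubfield L)), BorelSpace (v.adicCompletion ↥(maximalRealSubfield L))]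
  (ν : Measure ↥(adelicUnipotent ↥(maximalRealSubfield L) L (IsCMField.complexConj L) 3)) [ν.IsHaarMeasure]
  {𝓕 : Set ↥(adelicUnipotent ↥(maximalRealSubfield L) L (IsCMField.complexConj L) 3)} (h𝓕 : IsFundamentalDomain ↥(rationalUnipotent ↥(maximalRealSubfield L) L (IsCMField.complexConj L) 3) 𝓕 ν)
  (μE : Measure (AdeleRing (𝓞 L) L)) [μE.IsAddHaarMeasure] (μE₁ : Measure (InfiniteAdeleRing L)) [μE₁.IsAddHaarMeasure]
  (μE₂ : Measure (FiniteAdeleRing (𝓞 L) L)) [μE₂.IsAddHaarMeasure]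
  (μF : Measure (AdeleRing (𝓞 ↥(maximalRealSubfield L)) ↥(maximalRealSubfield L))) [μF.IsAddHaarMeasure] (μF₁ : Measure (InfiniteAdeleRing ↥(maximalRealSubfield L))) [μF₁.IsAddHaarMeasure]
  (μF₂ : Measure (FiniteAdeleRing (𝓞 ↥(maximalRealSubfield L)) ↥(maximalRealSubfield L))) [μF₂.IsAddHaarMeasure]
  (νv : ∀ v : HeightOneSpectrum (𝓞 ↥(maximalRealSubfield L)), Measure (v.adicCompletion ↥(maximalRealSubfield L))) [∀ v, (νv v).IsAddHaarMeasure]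
  {φ : HeckeCharacter L} {ψ : HeckeCharacter ↥(maximalRealSubfield L)} (hφ : φ.IsUnitary) (hψ : (ψ * quadraticHeckeCharCM L).IsUnitary)
  (hres : ∀ x, φ (AdeleRing.ideleBaseChange ↥(maximalRealSubfield L) L x) = ψ x)

include hd h𝓕 μE μF hφ hψ hres in
/-- **THE UNFOLDING ROW WITH A HOLOMORPHIC AMPLITUDE, BOUNDED WEIGHTS** — ★ p864845 `exists_differentiableOn_unfolding_eq_ratio_mul_of_letters` VERBATIM except that the finite weights
are bounded by `Mv v` on `S₀` and the archimedean weight by `Minf` (instead of `1`): `∃ A, DifferentiableOn ℂ A {1 < Re} ∧ ∀ z, 2 < Re z → (ν𝓕)⁻¹•∫ T_z dν = c_S(z)·A(z)` — ★ (a-2b)'s identity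
★ `unfolding_eq_ratio_mul_amplitude_of_letters` (bound-free) ∘ §1. [cite: MoeglinWaldspurger1995, IV.1.11] [cite: Titchmarsh1939, §2.8] [cite: Langlands1976, Appendix] -/
theorem exists_differentiableOn_unfolding_eq_ratio_mul_of_bounded_letters (S₀ : Finset (HeightOneSpectrum (𝓞 ↥(maximalRealSubfield L))))
    (hgood : ∀ v ∉ S₀, (Algebra.IsUnramifiedIn (𝓞 L) v.asIdeal ∧ Valued.v (2 : v.adicCompletion ↥(maximalRealSubfield L)) = 1 ∧
      ∀ w : PlacesOver L v, Valued.v (algebraMap L (LocalRing L v) δ w) = 1) ∧ ∀ w : PlacesOver L v, φ.IsUnramifiedAt w.1)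
    (ω : ∀ v : HeightOneSpectrum (𝓞 ↥(maximalRealSubfield L)), (Fin 3 → v.adicCompletion ↥(maximalRealSubfield L)) → ℂ)
    (hωc : ∀ z : ℂ, 2 < z.re → ∀ v, Continuous fun p : Fin 3 → v.adicCompletion ↥(maximalRealSubfield L) =>
      ω v p * (((∏ w' : PlacesOver L v, max 1 (max ((normAbs (w'.1.adicCompletion L) (quadraticLocalEquiv L v (IsCMField.complexConj L) hcδ hδ (p 0, p 1) w') : ℝ≥0) : ℝ)
          ((normAbs (w'.1.adicCompletion L) ((toLocalRing L v (p 2) * algebraMap L (LocalRing L v) δ -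
            toLocalRing L v 2⁻¹ * (quadraticLocalEquiv L v (IsCMField.complexConj L) hcδ hδ (p 0, p 1) *
              conjLocal L (IsCMField.complexConj L) v (quadraticLocalEquiv L v (IsCMField.complexConj L) hcδ hδ (p 0, p 1)))) w') : ℝ≥0) : ℝ))) : ℝ) : ℂ) ^ (-z))
    (hωm : ∀ v ∈ S₀, AEStronglyMeasurable (ω v) (Measure.pi fun _ : Fin 3 => νv v)) {Mv : HeightOneSpectrum (𝓞 ↥(maximalRealSubfield L)) → ℝ} (hωb : ∀ v ∈ S₀, ∀ p, ‖ω v p‖ ≤ Mv v)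
    (hω1 : ∀ v ∉ S₀, ∀ p ∈ integralBox ↥(maximalRealSubfield L) (Fin 3) v, ω v p = 1)
    (ωinf : InfiniteAdeleRing L → InfiniteAdeleRing ↥(maximalRealSubfield L) → ℂ)
    (hωinfm : AEStronglyMeasurable (fun p : InfiniteAdeleRing L × InfiniteAdeleRing ↥(maximalRealSubfield L) => ωinf p.1 p.2) (μE₁.prod μF₁)) {Minf : ℝ} (hωinfb : ∀ Xi a, ‖ωinf Xi a‖ ≤ Minf)
    (Ω : FiniteAdeleRing (𝓞 L) L → FiniteAdeleRing (𝓞 ↥(maximalRealSubfield L)) ↥(maximalRealSubfield L) → ℂ)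
    (hΩ : ∀ x : Fin 3 → FiniteAdeleRing (𝓞 ↥(maximalRealSubfield L)) ↥(maximalRealSubfield L),
      Ω (quadraticFiniteAdeleMap ↥(maximalRealSubfield L) L δ (x 0, x 1)) (x 2) = ∏ᶠ v : HeightOneSpectrum (𝓞 ↥(maximalRealSubfield L)), ω v (fun i => x i v))
    (T : ℂ → ↥(adelicUnipotent ↥(maximalRealSubfield L) L (IsCMField.complexConj L) 3) → ℂ) (hT : ∀ z : ℂ, 2 < z.re → Integrable (T z) ν)
    (hfac : ∀ z : ℂ, 2 < z.re → ∀ (X : AdeleRing (𝓞 L) L) (s : AdeleRing (𝓞 ↥(maximalRealSubfield L)) ↥(maximalRealSubfield L)),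
      T z (heisChart hc (X, traceZeroLine ↥(maximalRealSubfield L) L (IsCMField.complexConj L) hcδ hδ s)) =
        (ωinf (X.1) (s.1) * ((((∏ w : InfinitePlace L, ((1 + ‖(X.1) w‖ ^ 2 / 2) ^ 2 + (w δ) ^ 2 * (((InfiniteAdeleRing.ringEquiv_mixedSpace ↥(maximalRealSubfield L)) s.1).1 ⟨w.comap (algebraMap ↥(maximalRealSubfield L) L), K2E1HeightBigCellLineFormulaU2.isReal_comap_maximalRealSubfield L w⟩) ^ 2))) : ℝ) : ℂ) ^ (-z)) *
          (Ω (X.2) (s.2) * ((((∏ᶠ w : HeightOneSpectrum (𝓞 L), max 1 (max ‖((X) : AdeleRing (𝓞 L) L).2 w‖₊ ‖(heisZ (c := IsCMField.complexConj L) ((X) : AdeleRing (𝓞 L) L) ((traceZeroLine ↥(maximalRealSubfield L) L (IsCMField.complexConj L) hcδ hδ ((0, s.2) : AdeleRing (𝓞 ↥(maximalRealSubfield L)) ↥(maximalRealSubfield L)) : traceZeroAdele ↥(maximalRealSubfield L) L (IsCMField.complexConj L)) : AdeleRing (𝓞 L) L)).2 w‖₊) : ℝ≥0) : ℝ) : ℂ)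 ^ (-z))))
    (hfin : ∀ z : ℂ, 2 < z.re → Integrable (fun q : FiniteAdeleRing (𝓞 L) L × FiniteAdeleRing (𝓞 ↥(maximalRealSubfield L)) ↥(maximalRealSubfield L) =>
      (Ω (q.1) (q.2) * ((((∏ᶠ w : HeightOneSpectrum (𝓞 L), max 1 (max ‖((((0 : InfiniteAdeleRing L)), q.1) : AdeleRing (𝓞 L) L).2 w‖₊ ‖(heisZ (c := IsCMField.complexConj L) ((((0 : InfiniteAdeleRing L)), q.1) : AdeleRing (𝓞 L) L) ((traceZeroLine ↥(maximalRealSubfield L) L (IsCMField.complexConj L) hcδ hδ ((0, q.2) : AdeleRing (𝓞 ↥(maximalRealSubfield L)) ↥(maximalRealSubfield L)) : traceZeroAdele ↥(maximalRealSubfield L) L (IsCMField.complexConj L)) : AdeleRing (𝓞 L) L)).2 w‖₊) : ℝ≥0) : ℝ) : ℂ) ^ (-z)))) (μE₂.prod μF₂))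
    (hin : ∀ z : ℂ, 2 < z.re → ∀ v ∉ S₀, ∀ w : PlacesOver L v, IsCMField.complexConj L • w.1 = w.1 →
      ((Measure.pi fun _ : Fin 3 => νv v) (integralBox ↥(maximalRealSubfield L) (Fin 3) v)).toReal⁻¹ •
          ∫ p : Fin 3 → v.adicCompletion ↥(maximalRealSubfield L),
            ω v p * (((∏ w' : PlacesOver L v, max 1 (max ((normAbs (w'.1.adicCompletion L) (quadraticLocalEquiv L v (IsCMField.complexConj L) hcδ hδ (p 0, p 1) w') : ℝ≥0) : ℝ)
              ((normAbs (w'.1.adicCompletion L) ((toLocalRing L v (p 2) * algebraMap L (LocalRing L v) δ -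
                toLocalRing L v 2⁻¹ * (quadraticLocalEquiv L v (IsCMField.complexConj L) hcδ hδ (p 0, p 1) *
                  conjLocal L (IsCMField.complexConj L) v (quadraticLocalEquiv L v (IsCMField.complexConj L) hcδ hδ (p 0, p 1)))) w') : ℝ≥0) : ℝ))) : ℝ) : ℂ) ^ (-z)
            ∂(Measure.pi fun _ : Fin 3 => νv v) =
        (1 - φ.valueAtUniformizer w.1 * (v.residueCard : ℂ) ^ (-(2 * z))) * (1 + φ.valueAtUniformizer w.1 * (v.residueCard : ℂ) ^ (-(2 * z - 1))) /
          ((1 - φ.valueAtUniformizer w.1 * (v.residueCard : ℂ) ^ (-(2 * z - 2))) * (1 + φ.valueAtUniformizer w.1 * (v.residueCard : ℂ) ^ (-(2 * z - 2)))))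
    (hsp : ∀ z : ℂ, 2 < z.re → ∀ v ∉ S₀, ∀ w : PlacesOver L v, IsCMField.complexConj L • w.1 ≠ w.1 →
      ((Measure.pi fun _ : Fin 3 => νv v) (integralBox ↥(maximalRealSubfield L) (Fin 3) v)).toReal⁻¹ •
          ∫ p : Fin 3 → v.adicCompletion ↥(maximalRealSubfield L),
            ω v p * (((∏ w' : PlacesOver L v, max 1 (max ((normAbs (w'.1.adicCompletion L) (quadraticLocalEquiv L v (IsCMField.complexConj L) hcδ hδ (p 0, p 1) w') : ℝ≥0) : ℝ)
              ((normAbs (w'.1.adicCompletion L) ((toLocalRing L v (p 2) * algebraMap L (LocalRing L v) δ -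
                toLocalRing L v 2⁻¹ * (quadraticLocalEquiv L v (IsCMField.complexConj L) hcδ hδ (p 0, p 1) *
                  conjLocal L (IsCMField.complexConj L) v (quadraticLocalEquiv L v (IsCMField.complexConj L) hcδ hδ (p 0, p 1)))) w') : ℝ≥0) : ℝ))) : ℝ) : ℂ) ^ (-z)
            ∂(Measure.pi fun _ : Fin 3 => νv v) =
        (1 - φ.valueAtUniformizer w.1 * (v.residueCard : ℂ) ^ (-z)) * (1 - φ.valueAtUniformizer (PlacesOver.galInv (IsCMField.complexConj L) w).1 * (v.residueCard : ℂ) ^ (-z)) *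
            (1 - φ.valueAtUniformizer w.1 * φ.valueAtUniformizer (PlacesOver.galInv (IsCMField.complexConj L) w).1 * (v.residueCard : ℂ) ^ (-(2 * z - 1))) /
          ((1 - φ.valueAtUniformizer w.1 * (v.residueCard : ℂ) ^ (-(z - 1))) * (1 - φ.valueAtUniformizer (PlacesOver.galInv (IsCMField.complexConj L) w).1 * (v.residueCard : ℂ) ^ (-(z - 1))) *
            (1 - φ.valueAtUniformizer w.1 * φ.valueAtUniformizer (PlacesOver.galInv (IsCMField.complexConj L) w).1 * (v.residueCard : ℂ) ^ (-(2 * z - 2))))) :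
    ∃ A : ℂ → ℂ, DifferentiableOn ℂ A {z : ℂ | 1 < z.re} ∧ ∀ z : ℂ, 2 < z.re →
      ((ν 𝓕).toReal⁻¹ : ℝ) • ∫ v : ↥(adelicUnipotent ↥(maximalRealSubfield L) L (IsCMField.complexConj L) 3), T z v ∂ν =
        ((partialStandardL {w : HeightOneSpectrum (𝓞 L) | w.under (𝓞 ↥(maximalRealSubfield L)) ∈ (↑S₀ : Set (HeightOneSpectrum (𝓞 ↥(maximalRealSubfield L))))} (fun w => {φ.valueAtUniformizer w}) (z - 1) *
            partialStandardL (↑S₀ : Set (HeightOneSpectrum (𝓞 ↥(maximalRealSubfield L)))) (fun v => {(ψ * quadraticHeckeCharCM L).valueAtUniformizer v}) (2 * z - 2)) /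
          (partialStandardL {w : HeightOneSpectrum (𝓞 L) | w.under (𝓞 ↥(maximalRealSubfield L)) ∈ (↑S₀ : Set (HeightOneSpectrum (𝓞 ↥(maximalRealSubfield L))))} (fun w => {φ.valueAtUniformizer w}) z *
            partialStandardL (↑S₀ : Set (HeightOneSpectrum (𝓞 ↥(maximalRealSubfield L)))) (fun v => {(ψ * quadraticHeckeCharCM L).valueAtUniformizer v}) (2 * z - 1))) * A z := by
  have hA := differentiableOn_chiAmplitude_three_of_bounds L hcδ hδ hd μE₁ μF₁ νv ((unfoldingHaarConst L hc hcδ hδ hd ν h𝓕 μE μE₁ μE₂ μF μF₁ μF₂ νv hφ hψ hres : ℝ) : ℂ) S₀ ω hωm hωb ωinf hωinfm hωinfb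
  exact ⟨_, hA, fun z hz => unfolding_eq_ratio_mul_amplitude_of_letters L hc hcδ hδ hd ν h𝓕 μE μE₁ μE₂ μF μF₁ μF₂ νv hφ hψ hres S₀ hgood ω hωc hω1 ωinf Ω hΩ T hT hfac hfin hin hsp hz⟩
end Engine

end Summit.HodgeConjecture.HodgeConjecture.Cruxes.H413.K2E1ChiUnfoldingBoundedAmplitudeU3

end
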